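import Summits.CriticalPhenomena.CardyFormulaZ2.Theses.CardySelfRefinement
import Literature.Probability.Percolation.QuadCrossingSpaceZ2
import HarnessLib

/-!
# Covariance from the dictionary: stub `stub_covarianceFromDictionary` of line
`crosscut-dictionary` for crux `LagHandOff` (stmt-CriticalPhenomena-10268)

The decoded chordal family `P D := (Ψ D)_* μ` of a Borel, similarity-EQUIVARIANT decoder
`Ψ : DobrushinDomain → ℋ_ℂ → CurveClass ℂ` and a law `μ` on the Schramm–Smirnov space
`ℋ_ℂ = QuadConfig univ` which is invariant under rotations about the origin, dilations by
positive reals and translations is similarity covariant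
(`ChordalFamily.IsSimilarityCovariant`).

Proof (a push-forward computation, the only place where the crux's two antecedents
`RotationInput` / `ScaleInvariantLimits` enter the line): every orientation-preserving
similarity `φ = similarity c hc w : z ↦ c z + w` factors as
`(rotation e^{i arg c}) ≫ (dilation ‖c‖) ≫ (translation w)` (`Complex.norm_mul_exp_arg_mul_I`),
so `μ` is `φ`-invariant (`QuadConfig.mapHomeomorph_trans`, `Measure.map_map`); then
`P (φ D) = (Ψ_{φD})_* μ = (Ψ_{φD})_* (φ_* μ) = (Ψ_{φD} ∘ (φ ·))_* μ = (CurveClass.map φ ∘ Ψ_D)_* μ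
 = (P D).map (CurveClass.map φ)` by equivariance.  Werner 2007 §3.2 (similarity covariance).
-/

noncomputable section

open MeasureTheory Filter Set Topology
open scoped BoundedContinuousFunction
open Literature.Probability.Percolation Literature.Probability.LatticeModels
open Literature.Probability.RandomPlanarGeometry Literature.Probability.Percolation.QuadCrossing
open Summit.CriticalPhenomena.CardyFormulaZ2.Theses.CardySelfRefinement

namespace Summit.CriticalPhenomena.CardyFormulaZ2.Cruxes.LagHandOff.CrosscutDictionary

-- adapted from Lines/hitting-tournament.lean (`map_mapHomeomorph_similarity_eq`)
/-- **Where rotation, dilation and translation invariance are used.** A law on `ℋ_ℂ` invariant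
under rotations about the origin, dilations by positive reals and translations is invariant
under every orientation-preserving similarity `z ↦ c z + w`:
`similarity c hc w = (rotation e^{i arg c}) ≫ (dilation ‖c‖) ≫ (translation w)`. -/
theorem map_mapHomeomorph_similarity_eq_of_invariant
    {μ : FiniteMeasure (QuadConfig (univ : Set ℂ))}
    (hrot : ∀ α : ℝ, isometryLaw (rotation (Circle.exp α)).toIsometryEquiv μ = μ)
    (hdil : ∀ (t : ℝ) (ht : 0 < t), dilateLaw t ht.ne' μ = μ)
    (htrans : ∀ w : ℂ, μ.map (QuadConfig.translate w) = μ)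
    (c : ℂ) (hc : c ≠ 0) (w : ℂ) :
    (μ : Measure (QuadConfig (univ : Set ℂ))).map (QuadConfig.mapHomeomorph (similarity c hc w)) =
      μ := by
  have hpos : 0 < ‖c‖ := norm_pos_iff.mpr hc
  -- the three generators
  let g₁ : ℂ ≃ₜ ℂ := (rotation (Circle.exp (Complex.arg c))).toIsometryEquiv.toHomeomorph
  let g₂ : ℂ ≃ₜ ℂ := Homeomorph.mulLeft₀ ((‖c‖ : ℝ) : ℂ) (Complex.ofReal_ne_zero.mpr hpos.ne')
  let g₃ : ℂ ≃ₜ ℂ := Homeomorph.addLeft w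
  have hg₁ : ∀ z : ℂ, g₁ z = (Circle.exp (Complex.arg c) : ℂ) * z := fun z => rfl
  have hdecomp : similarity c hc w = (g₁.trans g₂).trans g₃ := by
    refine Homeomorph.ext fun z => ?_
    rw [similarity_apply, Homeomorph.trans_apply, Homeomorph.trans_apply, hg₁]
    change c * z + w = w + ((‖c‖ : ℝ) : ℂ) * ((Circle.exp (Complex.arg c) : ℂ) * z)
    rw [Circle.coe_exp, ← mul_assoc, Complex.norm_mul_exp_arg_mul_I, add_comm]
  -- invariance under each generator
  have i₁ : (μ : Measure (QuadConfig (univ : Set ℂ))).map (QuadConfig.mapHomeomorph g₁) = μ := by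
    have h := congrArg FiniteMeasure.toMeasure (hrot (Complex.arg c))
    rw [isometryLaw, FiniteMeasure.toMeasure_map] at h
    exact h
  have i₂ : (μ : Measure (QuadConfig (univ : Set ℂ))).map (QuadConfig.mapHomeomorph g₂) = μ := by
    have h := congrArg FiniteMeasure.toMeasure (hdil ‖c‖ hpos)
    rw [dilateLaw, FiniteMeasure.toMeasure_map] at h
    exact h
  have i₃ : (μ : Measure (QuadConfig (univ : Set ℂ))).map (QuadConfig.mapHomeomorph g₃) = μ := by
    have h := congrArg FiniteMeasure.toMeasure (htrans w)
    rw [FiniteMeasure.toMeasure_map] at h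
    exact h
  have hcomp : QuadConfig.mapHomeomorph (similarity c hc w) =
      QuadConfig.mapHomeomorph g₃ ∘ (QuadConfig.mapHomeomorph g₂ ∘ QuadConfig.mapHomeomorph g₁) := by
    funext S
    rw [hdecomp, QuadConfig.mapHomeomorph_trans, QuadConfig.mapHomeomorph_trans]
    rfl
  rw [hcomp, ← Measure.map_map (QuadConfig.measurable_mapHomeomorph g₃)
      ((QuadConfig.measurable_mapHomeomorph g₂).comp (QuadConfig.measurable_mapHomeomorph g₁)),
    ← Measure.map_map (QuadConfig.measurable_mapHomeomorph g₂)
      (QuadConfig.measurable_mapHomeomorph g₁), i₁, i₂, i₃]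

-- adapted from Lines/hitting-tournament.lean (`isSimilarityCovariant_lawFamily`)
/-- **Stub `stub_covarianceFromDictionary`.** Similarity covariance of the decoded family
`P D = (Ψ D)_* μ` from the invariance of `μ` under rotations, dilations and translations and the
similarity equivariance of the Borel decoder `Ψ` (a push-forward computation). -/
theorem stub_covarianceFromDictionary : ∀ Ψ : DobrushinDomain → QuadConfig (Set.univ : Set ℂ) → CurveClass ℂ, (∀ D : DobrushinDomain, Measurable (Ψ D)) → (∀ (D : DobrushinDomain) (c : ℂ) (hc : c ≠ 0) (w : ℂ) (S : QuadConfig (Set.univ : Set ℂ)), Ψ (D.map (similarity c hc w)) (S.mapHomeomorph (similarity c hc w)) = (Ψ D S).map (similarity c hc w : C(ℂ, ℂ))) → ∀ μ : FiniteMeasure (QuadConfig (Set.univ : Set ℂ)), (∀ α : ℝ, isometryLaw (rotation (Circle.exp α)).toIsometryEquiv μ = μ) → (∀ (t : ℝ) (ht : 0 < t), dilateLaw t ht.ne' μ = μ) → (∀ w : ℂ, μ.map (QuadConfig.translate w) = μ) → ChordalFamily.IsSimilarityCovariant (fun D => (μ : Measure (QuadConfig (Set.univ : Set ℂ))).map (Ψ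 D)) := by
  intro Ψ hmeas hequiv μ hrot hdil htrans D c hc w
  change (μ : Measure (QuadConfig (univ : Set ℂ))).map (Ψ (D.map (similarity c hc w))) =
    ((μ : Measure (QuadConfig (univ : Set ℂ))).map (Ψ D)).map
      (CurveClass.map (similarity c hc w : C(ℂ, ℂ)))
  rw [Measure.map_map (measurable_curveClassMap_similarity c hc w) (hmeas D)]
  have hfun : CurveClass.map (similarity c hc w : C(ℂ, ℂ)) ∘ Ψ D =
      Ψ (D.map (similarity c hc w)) ∘ QuadConfig.mapHomeomorph (similarity c hc w) :=
    funext fun S => (hequiv D c hc w S).symm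
  rw [hfun, ← Measure.map_map (hmeas _) (QuadConfig.measurable_mapHomeomorph _),
    map_mapHomeomorph_similarity_eq_of_invariant hrot hdil htrans c hc w]

end Summit.CriticalPhenomena.CardyFormulaZ2.Cruxes.LagHandOff.CrosscutDictionary

end
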